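import Literature.Probability.Percolation.LatticeSymmetry
import Literature.Probability.Percolation.PlanarDuality
import HarnessLib

/-!
# Route `PercTiltedBlockers`, item `WideBoxFromTilt` (stmt-CriticalPhenomena-6396) — tilt gluing

The deterministic TILT GLUING LEMMA for LATTICE configurations `ω ⊆ E(ℤ³)` (helper for
`WideBoxFromTilt`; the route's `TiltGluing` decl quantifies over all `ω : Set (Sym2 (Site 3))`,
including non-lattice "long edges", for which the statement fails — under `P_p` the restriction
is almost sure, `ae_subset_edgeSet`).

Boxes `R = [0,h]×[0,L]×[0,M]`, `R' = [0,h]×[δ,L+δ]×[0,M]`, `U = [0,h]×[0,L+δ]×[0,M]` of `ℤ³`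
(`x 0` = height), level `a`, `δ ≤ L`. If no open path inside `R` joins
`Src = {x₀ = 0} ∪ {x₁ = L, x₀ < a}` to `Tgt = {x₀ = h} ∪ {x₁ = δ, x₀ ≥ a}`, and no open path inside
`R'` joins `Src' = {x₀ = 0} ∪ {x₁ = δ, x₀ < a}` to `Tgt' = {x₀ = h} ∪ {x₁ = L, x₀ ≥ a}`, then no
open path inside `U` joins `{x₀ = 0}` to `{x₀ = h}`.

Proof: along an open bottom–top walk in `U` propagate the invariant "`v ∈ R ⇒ v` is open-reachable
inside `R` from `Src`; `v ∈ R' ⇒ v` is open-reachable inside `R'` from `Src'`": a lattice step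
entering `R` from `U ∖ R` lands on the plane `x₁ = L` (low part: in `Src`; high part: in `Tgt'`,
contradiction via the `R'`-invariant), symmetrically for `R'` through the plane `x₁ = δ`; the
endpoint lies in `Tgt` or `Tgt'`.
-/

namespace Summit.CriticalPhenomena.PercolationContinuityZ3.Theorems

open Literature.Probability.Percolation Literature.Probability.LatticeModels

/-- Membership in an order box `Icc a b` of `ℤ³`, coordinatewise. [folklore] -/
theorem tilt_mem_Icc_iff (a b x : Site 3) :
    x ∈ Finset.Icc a b ↔ (a 0 ≤ x 0 ∧ a 1 ≤ x 1 ∧ a 2 ≤ x 2) ∧ (x 0 ≤ b 0 ∧ x 1 ≤ b 1 ∧ x 2 ≤ b 2) := by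
  simp [Finset.mem_Icc, Pi.le_def, Fin.forall_fin_succ]

/-- Coordinates of two neighbours of `ℤ³`: they agree in two coordinates and differ by one in the
third. [folklore] -/
theorem tilt_adj_coords {u v : Site 3} (huv : (zdGraph 3).Adj u v) :
    (u 0 = v 0 ∧ u 2 = v 2 ∧ (v 1 = u 1 + 1 ∨ u 1 = v 1 + 1)) ∨
      (u 1 = v 1 ∧ ((u 0 = v 0 ∧ (v 2 = u 2 + 1 ∨ u 2 = v 2 + 1)) ∨
        (u 2 = v 2 ∧ (v 0 = u 0 + 1 ∨ u 0 = v 0 + 1)))) := by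
  rw [zdGraph_adj_iff] at huv
  obtain ⟨i, huv | huv⟩ := huv
  · fin_cases i <;> simp [huv]
  · fin_cases i <;> simp [huv]

/-- **Tilt gluing lemma** (lattice configurations). See the module docstring. [folklore] -/
theorem tilt_gluing {h L M δ a : ℕ} (hδ : δ ≤ L) {ω : BondConfig (Site 3)}
    (hω : ω ⊆ (zdGraph 3).edgeSet)
    (h1 : ¬ ∃ x ∈ Finset.Icc (0 : Site 3) ![(h : ℤ), L, M], ∃ y ∈ Finset.Icc (0 : Site 3) ![(h : ℤ), L, M],
      (x 0 = 0 ∨ (x 1 = L ∧ x 0 < a)) ∧ (y 0 = h ∨ (y 1 = δ ∧ (a : ℤ) ≤ y 0)) ∧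
        ω ∈ openConnIn ↑(Finset.Icc (0 : Site 3) ![(h : ℤ), L, M]) x y)
    (h2 : ¬ ∃ x ∈ Finset.Icc (![0, (δ : ℤ), 0] : Site 3) ![(h : ℤ), L + δ, M],
      ∃ y ∈ Finset.Icc (![0, (δ : ℤ), 0] : Site 3) ![(h : ℤ), L + δ, M],
      (x 0 = 0 ∨ (x 1 = δ ∧ x 0 < a)) ∧ (y 0 = h ∨ (y 1 = L ∧ (a : ℤ) ≤ y 0)) ∧
        ω ∈ openConnIn ↑(Finset.Icc (![0, (δ : ℤ), 0] : Site 3) ![(h : ℤ), L + δ, M]) x y) :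
    ¬ ∃ x ∈ Finset.Icc (0 : Site 3) ![(h : ℤ), L + δ, M], ∃ y ∈ Finset.Icc (0 : Site 3) ![(h : ℤ), L + δ, M],
      x 0 = 0 ∧ y 0 = h ∧ ω ∈ openConnIn ↑(Finset.Icc (0 : Site 3) ![(h : ℤ), L + δ, M]) x y := by
  -- the three boxes
  set R : Finset (Site 3) := Finset.Icc (0 : Site 3) ![(h : ℤ), L, M] with hR
  set R' : Finset (Site 3) := Finset.Icc (![0, (δ : ℤ), 0] : Site 3) ![(h : ℤ), L + δ, M] with hR'
  set U : Finset (Site 3) := Finset.Icc (0 : Site 3) ![(h : ℤ), L + δ, M] with hU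
  have memR : ∀ x : Site 3, x ∈ R ↔ (0 ≤ x 0 ∧ 0 ≤ x 1 ∧ 0 ≤ x 2) ∧ (x 0 ≤ h ∧ x 1 ≤ L ∧ x 2 ≤ M) := by
    intro x; rw [hR, tilt_mem_Icc_iff]; simp
  have memR' : ∀ x : Site 3, x ∈ R' ↔ (0 ≤ x 0 ∧ (δ : ℤ) ≤ x 1 ∧ 0 ≤ x 2) ∧ (x 0 ≤ h ∧ x 1 ≤ L + δ ∧ x 2 ≤ M) := by
    intro x; rw [hR', tilt_mem_Icc_iff]; simp
  have memU : ∀ x : Site 3, x ∈ U ↔ (0 ≤ x 0 ∧ 0 ≤ x 1 ∧ 0 ≤ x 2) ∧ (x 0 ≤ h ∧ x 1 ≤ L + δ ∧ x 2 ≤ M) := by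
    intro x; rw [hU, tilt_mem_Icc_iff]; simp
  rintro ⟨x, hx, y, hy, hx0, hy0, hxU, hyU, hreach⟩
  -- the invariant
  set Inv : Site 3 → Prop := fun v =>
    (v ∈ R → ∃ s ∈ R, (s 0 = 0 ∨ (s 1 = L ∧ s 0 < a)) ∧ ω ∈ openConnIn ↑R s v) ∧
    (v ∈ R' → ∃ s ∈ R', (s 0 = 0 ∨ (s 1 = δ ∧ s 0 < a)) ∧ ω ∈ openConnIn ↑R' s v) with hInv
  -- propagation along one open lattice edge inside `U`
  have step : ∀ u v : Site 3, u ∈ U → v ∈ U → (openGraph ω).Adj u v → Inv u → Inv v := by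
    intro u v hu hv hadj hIu
    have he := (openGraph_adj ω u v).1 hadj
    have hadjZ : (zdGraph 3).Adj u v := (SimpleGraph.mem_edgeSet _).1 (hω he.1)
    have hco := tilt_adj_coords hadjZ
    have huU := (memU u).1 hu
    have hvU := (memU v).1 hv
    refine ⟨fun hvR => ?_, fun hvR' => ?_⟩
    · -- `v ∈ R`
      by_cases huR : u ∈ R
      · obtain ⟨s, hs, hsrc, hsu⟩ := hIu.1 huR
        exact ⟨s, hs, hsrc, PlanarDuality.openConnIn_trans hsu (openConnIn_of_adj huR hvR he.1 he.2)⟩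
      · -- `u ∉ R`: the step enters `R` through the plane `x₁ = L`
        have hvR1 := (memR v).1 hvR
        have hu1 : (L : ℤ) < u 1 := by
          by_contra hle
          exact huR ((memR u).2 ⟨⟨huU.1.1, huU.1.2.1, huU.1.2.2⟩, huU.2.1, not_lt.1 hle, huU.2.2.2⟩)
        have hv1 : v 1 = L ∧ u 1 = L + 1 ∧ u 0 = v 0 ∧ u 2 = v 2 := by omega
        by_cases hva : v 0 < a
        · exact ⟨v, hvR, Or.inr ⟨hv1.1, hva⟩, openConnIn_refl hvR⟩
        · exfalso
          have huR' : u ∈ R' := (memR' u).2 ⟨⟨huU.1.1, by omega, huU.1.2.2⟩, huU.2.1, huU.2.2.1, huU.2.2.2⟩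
          have hvR' : v ∈ R' := (memR' v).2 ⟨⟨hvU.1.1, by omega, hvU.1.2.2⟩, hvU.2.1, hvU.2.2.1, hvU.2.2.2⟩
          obtain ⟨s, hs, hsrc, hsu⟩ := hIu.2 huR'
          exact h2 ⟨s, hs, v, hvR', hsrc, Or.inr ⟨hv1.1, not_lt.1 hva⟩,
            PlanarDuality.openConnIn_trans hsu (openConnIn_of_adj huR' hvR' he.1 he.2)⟩
    · -- `v ∈ R'`
      by_cases huR' : u ∈ R'
      · obtain ⟨s, hs, hsrc, hsu⟩ := hIu.2 huR'
        exact ⟨s, hs, hsrc, PlanarDuality.openConnIn_trans hsu (openConnIn_of_adj huR' hvR' he.1 he.2)⟩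
      · -- `u ∉ R'`: the step enters `R'` through the plane `x₁ = δ`
        have hvR1 := (memR' v).1 hvR'
        have hu1 : u 1 < δ := by
          by_contra hle
          exact huR' ((memR' u).2 ⟨⟨huU.1.1, not_lt.1 hle, huU.1.2.2⟩, huU.2.1, huU.2.2.1, huU.2.2.2⟩)
        have hv1 : v 1 = δ ∧ u 1 + 1 = δ ∧ u 0 = v 0 ∧ u 2 = v 2 := by omega
        by_cases hva : v 0 < a
        · exact ⟨v, hvR', Or.inr ⟨hv1.1, hva⟩, openConnIn_refl hvR'⟩
        · exfalso
          have huR : u ∈ R := (memR u).2 ⟨⟨huU.1.1, huU.1.2.1, huU.1.2.2⟩, huU.2.1, by omega, huU.2.2.2⟩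
          have hvR : v ∈ R := (memR v).2 ⟨⟨hvU.1.1, hvU.1.2.1, hvU.1.2.2⟩, hvU.2.1, by omega, hvU.2.2.2⟩
          obtain ⟨s, hs, hsrc, hsu⟩ := hIu.1 huR
          exact h1 ⟨s, hs, v, hvR, hsrc, Or.inr ⟨hv1.1, not_lt.1 hva⟩,
            PlanarDuality.openConnIn_trans hsu (openConnIn_of_adj huR hvR he.1 he.2)⟩
  -- the invariant holds at the start
  have start : Inv x :=
    ⟨fun hxR => ⟨x, hxR, Or.inl hx0, openConnIn_refl hxR⟩,
     fun hxR' => ⟨x, hxR', Or.inl hx0, openConnIn_refl hxR'⟩⟩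
  -- and propagates along the open walk inside `U`
  have propagate : ∀ v : ↥(↑U : Set (Site 3)),
      Relation.ReflTransGen ((openGraph ω).induce (↑U : Set (Site 3))).Adj ⟨x, hxU⟩ v → Inv v := by
    intro v hv
    induction hv with
    | refl => exact start
    | @tail b c _ hbc ih => exact step b c b.2 c.2 hbc ih
  have hInvy : Inv y := propagate ⟨y, hyU⟩ ((SimpleGraph.reachable_iff_reflTransGen _ _).1 hreach)
  have hyc := (memU y).1 hy
  by_cases hy1 : y 1 ≤ L
  · have hyR : y ∈ R := (memR y).2 ⟨hyc.1, hyc.2.1, hy1, hyc.2.2.2⟩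
    obtain ⟨s, hs, hsrc, hsy⟩ := hInvy.1 hyR
    exact h1 ⟨s, hs, y, hyR, hsrc, Or.inl hy0, hsy⟩
  · have hyR' : y ∈ R' := (memR' y).2 ⟨⟨hyc.1.1, by omega, hyc.1.2.2⟩, hyc.2⟩
    obtain ⟨s, hs, hsrc, hsy⟩ := hInvy.2 hyR'
    exact h2 ⟨s, hs, y, hyR', hsrc, Or.inl hy0, hsy⟩

end Summit.CriticalPhenomena.PercolationContinuityZ3.Theorems
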